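import Mathlib
import Summits.QuantumFields.YangMills.Theorems.AdjointLoopFanoDirichletKinematic
import HarnessLib

/-!
# `AdjointLoopDirichlet` from a WEIGHTED TEMPORAL PLAQUETTE MEAN (support for stmt-QuantumFields-23322; the prover memo's B2′)

Route `AdjointLoopFano` (LINE g16-B of seat ym-idea-4).  Corollary of the kinematic Dirichlet chain
(`deficit_adjLoop_le_weighted_plaquettes`): if every link of every direction-0 Polyakov loop has a `d_x`-WEIGHTED temporal plaquette mean
`≤ η` in the vacuum pair measure, i.e.

  `∫∫ ΩK_βΩ · (d_x(U)+d_x(V)) · (4 − 2Re tr U_{x_j}V_{x_j}⁻¹) ≤ η · ∫∫ ΩK_βΩ · (d_x(U)+d_x(V))`   for all sites `x` and `j < L`,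

then ★ `deficit_adjLoop_le_of_weightedPlaquette`: `λ₀‖FΩ‖² − ⟨FΩ, K_β(FΩ)⟩ ≤ 4L²·η·λ₀·⟨FΩ, Ω⟩` (`F = flowLift 0 d`).  With `η = Cβ^{ε−1}` this
is the `L²`-form B2′ of the item recorded in the prover memo (evidence #2 on stmt-QuantumFields-23322); the item's own `1/L` is out of reach of
this kinematic route (it needs decorrelation of link increments).  Ingredients beyond the chain: `∫∫ΩK_βΩ·d_x(U) = ∫∫ΩK_βΩ·d_x(V) = λ₀⟨d_xΩ,Ω⟩`
(symmetry of the transfer form, `qform_su2Rep_comm`, and the eigen-equation) and `Σ_x ⟨d_xΩ,Ω⟩ = |Λ|·⟨FΩ,Ω⟩`.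

HONEST FRAMING: a conditional reduction; the weighted plaquette mean (a Harnack-type property of `Ω`) and the crux are OPEN; K2a, R2ξ″ and the
YM mass gap are NOT proved.  No `sorry`, no new axiom, no new definition.  References: [cite: ReedSimonIV1978, Thm. XIII.1]; [cite: Luscher1983, §2].
-/

set_option autoImplicit false

noncomputable section

open MeasureTheory Filter Topology Real
open scoped Matrix ComplexConjugate BigOperators
open Literature.MathematicalPhysics.QuantumFieldTheory (GaugeConfig Site Edge gaugeTransform)
open Literature.MathematicalPhysics.QuantumLattice (fundamentalRep_apply secondCountableTopology_su2)

namespace Summit.QuantumFields.YangMills.Theorems.AdjointLoopFano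

open Summit.QuantumFields.YangMills.Theorems.FemtoTransferGap

variable {L : ℕ} [NeZero L]

/-- `∫∫ Ω(U)K_β(U,V)Ω(V)·g(U) = λ₀⟨gΩ, Ω⟩` for a physical multiplier-dressed `gΩ` and `K_βΩ = λ₀Ω`. [cite: ReedSimonIV1978, Thm. XIII.1] -/
theorem integral_pairWeight_mul_fst {β : ℝ} {Ω g : GaugeConfig 3 L SU2 → ℝ} (hΩ : IsPhys Ω) (hgΩ : IsPhys (fun U => g U * Ω U))
    (heig : transferApply β Ω = topValue su2Rep L β • Ω) :
    ∫ p, Ω p.1 * transferKernel su2Rep β p.1 p.2 * Ω p.2 * g p.1 ∂(configMeasure SU2 L).prod (configMeasure SU2 L) =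
      topValue su2Rep L β * l2 (fun U => g U * Ω U) Ω := by
  haveI : SecondCountableTopology SU2 := secondCountableTopology_su2
  have h := qform_eq_integral_prod su2Rep continuous_su2Rep β hgΩ hΩ
  have h2 : ∫ p, Ω p.1 * transferKernel su2Rep β p.1 p.2 * Ω p.2 * g p.1 ∂(configMeasure SU2 L).prod (configMeasure SU2 L) =
      ∫ p, g p.1 * Ω p.1 * transferKernel su2Rep β p.1 p.2 * Ω p.2 ∂(configMeasure SU2 L).prod (configMeasure SU2 L) :=
    integral_congr_ae (ae_of_all _ fun p => by ring)
  rw [h2, ← h, qform_eq_l2_transferApply, heig, l2_comm, l2_smul_left, l2_comm]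

/-- `∫∫ Ω(U)K_β(U,V)Ω(V)·g(V) = λ₀⟨gΩ, Ω⟩` (symmetry of the transfer form). [cite: ReedSimonIV1978, Thm. XIII.1] -/
theorem integral_pairWeight_mul_snd {β : ℝ} {Ω g : GaugeConfig 3 L SU2 → ℝ} (hΩ : IsPhys Ω) (hgΩ : IsPhys (fun U => g U * Ω U))
    (heig : transferApply β Ω = topValue su2Rep L β • Ω) :
    ∫ p, Ω p.1 * transferKernel su2Rep β p.1 p.2 * Ω p.2 * g p.2 ∂(configMeasure SU2 L).prod (configMeasure SU2 L) =
      topValue su2Rep L β * l2 (fun U => g U * Ω U) Ω := by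
  haveI : SecondCountableTopology SU2 := secondCountableTopology_su2
  have h := qform_eq_integral_prod su2Rep continuous_su2Rep β hΩ hgΩ
  have h2 : ∫ p, Ω p.1 * transferKernel su2Rep β p.1 p.2 * Ω p.2 * g p.2 ∂(configMeasure SU2 L).prod (configMeasure SU2 L) =
      ∫ p, Ω p.1 * transferKernel su2Rep β p.1 p.2 * (g p.2 * Ω p.2) ∂(configMeasure SU2 L).prod (configMeasure SU2 L) :=
    integral_congr_ae (ae_of_all _ fun p => by ring)
  rw [h2, ← h, qform_su2Rep_comm β hΩ hgΩ, qform_eq_l2_transferApply, heig, l2_comm, l2_smul_left, l2_comm]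

/-- The dressed deviation `d_x·Ω` is physical. [folklore] -/
theorem isPhys_adjLoopAt_mul (x : Site 3 L) {Ω : GaugeConfig 3 L SU2 → ℝ} (hΩ : IsPhys Ω) :
    IsPhys (fun U => flowLiftAt x 0 (fun u : GaugeConfig 3 1 SU2 => 4 - ((su2Rep (u ((0 : Site 3 1), (0 : Fin 3)))).trace.re) ^ 2) U * Ω U) := by
  have hd := isPhys_adjLoopAt (L := L) x
  obtain ⟨Cd, hCd⟩ := hd.bounded
  exact hΩ.mul_of_invariant hd.measurable hCd hd.gaugeInv hd.zeroFlux

/-- `Σ_x ⟨d_xΩ, Ω⟩ = |Λ| · ⟨FΩ, Ω⟩` for the site average `F = flowLift 0 d` of `d_x = flowLiftAt x 0 d`. [folklore] -/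
theorem sum_l2_adjLoopAt_eq {Ω : GaugeConfig 3 L SU2 → ℝ} (hΩ : IsPhys Ω) :
    ∑ x : Site 3 L, l2 (fun U => flowLiftAt x 0 (fun u : GaugeConfig 3 1 SU2 => 4 - ((su2Rep (u ((0 : Site 3 1), (0 : Fin 3)))).trace.re) ^ 2) U * Ω U) Ω =
      Fintype.card (Site 3 L) * l2 (fun U => flowLift 0 (fun u : GaugeConfig 3 1 SU2 => 4 - ((su2Rep (u ((0 : Site 3 1), (0 : Fin 3)))).trace.re) ^ 2) U * Ω U) Ω := by
  have hN : (Fintype.card (Site 3 L) : ℝ) ≠ 0 := by exact_mod_cast Fintype.card_ne_zero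
  have hint : ∀ x : Site 3 L, Integrable (fun U => flowLiftAt x 0 (fun u : GaugeConfig 3 1 SU2 => 4 - ((su2Rep (u ((0 : Site 3 1), (0 : Fin 3)))).trace.re) ^ 2) U * Ω U * Ω U) (configMeasure SU2 L) := fun x =>
    (isPhys_adjLoopAt_mul x hΩ).integrable_mul hΩ
  unfold l2
  rw [← integral_finsetSum _ (fun x _ => hint x), ← integral_const_mul]
  refine integral_congr_ae (ae_of_all _ fun U => ?_)
  have hF : flowLift 0 (fun u : GaugeConfig 3 1 SU2 => 4 - ((su2Rep (u ((0 : Site 3 1), (0 : Fin 3)))).trace.re) ^ 2) U = (∑ x : Site 3 L, flowLiftAt x 0 (fun u : GaugeConfig 3 1 SU2 => 4 - ((su2Rep (u ((0 : Site 3 1), (0 : Fin 3)))).trace.re) ^ 2) U) / Fintype.card (Site 3 L) := rfl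
  dsimp only
  rw [hF, ← Finset.sum_mul, ← Finset.sum_mul]
  field_simp

/-- ★ **`AdjointLoopDirichlet`, `L²`-form, from a weighted temporal plaquette mean.**  `β ≥ 0`; `Ω ≥ 0` physical, `K_βΩ = λ₀Ω`; if for every
site `x` and every `j < L` the `(d_x(U)+d_x(V))`-weighted mean of the temporal plaquette `4 − 2Re tr(U_{x_j}V_{x_j}⁻¹)` in the vacuum pair measure is
`≤ η`, then `λ₀‖FΩ‖² − ⟨FΩ, K_β(FΩ)⟩ ≤ 4L²·η·λ₀·⟨FΩ,Ω⟩`. [cite: ReedSimonIV1978, Thm. XIII.1] [cite: Luscher1983, §2] -/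
theorem deficit_adjLoop_le_of_weightedPlaquette {β : ℝ} (hβ : 0 ≤ β) {Ω : GaugeConfig 3 L SU2 → ℝ} (hΩ : IsPhys Ω)
    (hΩnn : ∀ U, 0 ≤ Ω U) (heig : transferApply β Ω = topValue su2Rep L β • Ω) {η : ℝ}
    (hW : ∀ (x : Site 3 L) (j : ℕ), j < L →
      ∫ p, Ω p.1 * transferKernel su2Rep β p.1 p.2 * Ω p.2 *
          ((flowLiftAt x 0 (fun u : GaugeConfig 3 1 SU2 => 4 - ((su2Rep (u ((0 : Site 3 1), (0 : Fin 3)))).trace.re) ^ 2) p.1 + flowLiftAt x 0 (fun u : GaugeConfig 3 1 SU2 => 4 - ((su2Rep (u ((0 : Site 3 1), (0 : Fin 3)))).trace.re) ^ 2) p.2) *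
            (4 - 2 * (((p.1 ((fun z : Site 3 L => z.shift 0)^[j] x, 0) * (p.2 ((fun z : Site 3 L => z.shift 0)^[j] x, 0))⁻¹ : SU2) :
              Matrix (Fin 2) (Fin 2) ℂ).trace.re)))
          ∂(configMeasure SU2 L).prod (configMeasure SU2 L) ≤
        η * ∫ p, Ω p.1 * transferKernel su2Rep β p.1 p.2 * Ω p.2 *
          (flowLiftAt x 0 (fun u : GaugeConfig 3 1 SU2 => 4 - ((su2Rep (u ((0 : Site 3 1), (0 : Fin 3)))).trace.re) ^ 2) p.1 + flowLiftAt x 0 (fun u : GaugeConfig 3 1 SU2 => 4 - ((su2Rep (u ((0 : Site 3 1), (0 : Fin 3)))).trace.re) ^ 2) p.2) ∂(configMeasure SU2 L).prod (configMeasure SU2 L)) :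
    topValue su2Rep L β * l2 (fun U => flowLift 0 (fun u : GaugeConfig 3 1 SU2 => 4 - ((su2Rep (u ((0 : Site 3 1), (0 : Fin 3)))).trace.re) ^ 2) U * Ω U) (fun U => flowLift 0 (fun u : GaugeConfig 3 1 SU2 => 4 - ((su2Rep (u ((0 : Site 3 1), (0 : Fin 3)))).trace.re) ^ 2) U * Ω U) -
        qform su2Rep β (fun U => flowLift 0 (fun u : GaugeConfig 3 1 SU2 => 4 - ((su2Rep (u ((0 : Site 3 1), (0 : Fin 3)))).trace.re) ^ 2) U * Ω U) (fun U => flowLift 0 (fun u : GaugeConfig 3 1 SU2 => 4 - ((su2Rep (u ((0 : Site 3 1), (0 : Fin 3)))).trace.re) ^ 2) U * Ω U) ≤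
      4 * (L : ℝ) ^ 2 * η * (topValue su2Rep L β * l2 (fun U => flowLift 0 (fun u : GaugeConfig 3 1 SU2 => 4 - ((su2Rep (u ((0 : Site 3 1), (0 : Fin 3)))).trace.re) ^ 2) U * Ω U) Ω) := by
  have hkin := deficit_adjLoop_le_weighted_plaquettes (L := L) hβ hΩ hΩnn heig
  have hN : (0 : ℝ) < Fintype.card (Site 3 L) := by exact_mod_cast Fintype.card_pos
  -- the unweighted pair integrals `J_x = 2 λ₀ ⟨d_xΩ, Ω⟩`
  have hJ : ∀ x : Site 3 L,
      ∫ p, Ω p.1 * transferKernel su2Rep β p.1 p.2 * Ω p.2 * (flowLiftAt x 0 (fun u : GaugeConfig 3 1 SU2 => 4 - ((su2Rep (u ((0 : Site 3 1), (0 : Fin 3)))).trace.re) ^ 2) p.1 + flowLiftAt x 0 (fun u : GaugeConfig 3 1 SU2 => 4 - ((su2Rep (u ((0 : Site 3 1), (0 : Fin 3)))).trace.re) ^ 2) p.2)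
          ∂(configMeasure SU2 L).prod (configMeasure SU2 L) =
        2 * (topValue su2Rep L β * l2 (fun U => flowLiftAt x 0 (fun u : GaugeConfig 3 1 SU2 => 4 - ((su2Rep (u ((0 : Site 3 1), (0 : Fin 3)))).trace.re) ^ 2) U * Ω U) Ω) := by
    intro x
    have hdΩ := isPhys_adjLoopAt_mul (L := L) x hΩ
    have hd := isPhys_adjLoopAt (L := L) x
    obtain ⟨Cd, hCd⟩ := hd.bounded
    have hi1 := integrable_pairWeight_mul (L := L) hβ hΩ (G := fun p => flowLiftAt x 0 (fun u : GaugeConfig 3 1 SU2 => 4 - ((su2Rep (u ((0 : Site 3 1), (0 : Fin 3)))).trace.re) ^ 2) p.1)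
      (hd.measurable.comp measurable_fst) (fun p => hCd p.1)
    have hi2 := integrable_pairWeight_mul (L := L) hβ hΩ (G := fun p => flowLiftAt x 0 (fun u : GaugeConfig 3 1 SU2 => 4 - ((su2Rep (u ((0 : Site 3 1), (0 : Fin 3)))).trace.re) ^ 2) p.2)
      (hd.measurable.comp measurable_snd) (fun p => hCd p.2)
    have hsplit : (fun p : GaugeConfig 3 L SU2 × GaugeConfig 3 L SU2 =>
        Ω p.1 * transferKernel su2Rep β p.1 p.2 * Ω p.2 * (flowLiftAt x 0 (fun u : GaugeConfig 3 1 SU2 => 4 - ((su2Rep (u ((0 : Site 3 1), (0 : Fin 3)))).trace.re) ^ 2) p.1 + flowLiftAt x 0 (fun u : GaugeConfig 3 1 SU2 => 4 - ((su2Rep (u ((0 : Site 3 1), (0 : Fin 3)))).trace.re) ^ 2) p.2)) =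
        fun p => Ω p.1 * transferKernel su2Rep β p.1 p.2 * Ω p.2 * flowLiftAt x 0 (fun u : GaugeConfig 3 1 SU2 => 4 - ((su2Rep (u ((0 : Site 3 1), (0 : Fin 3)))).trace.re) ^ 2) p.1 +
          Ω p.1 * transferKernel su2Rep β p.1 p.2 * Ω p.2 * flowLiftAt x 0 (fun u : GaugeConfig 3 1 SU2 => 4 - ((su2Rep (u ((0 : Site 3 1), (0 : Fin 3)))).trace.re) ^ 2) p.2 := by
      funext p; ring
    rw [hsplit, integral_add hi1 hi2, integral_pairWeight_mul_fst hΩ hdΩ heig, integral_pairWeight_mul_snd hΩ hdΩ heig]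
    ring
  -- sum over the `L` links of each loop
  have hx : ∀ x : Site 3 L,
      ∑ j ∈ Finset.range L, ∫ p, Ω p.1 * transferKernel su2Rep β p.1 p.2 * Ω p.2 *
          ((flowLiftAt x 0 (fun u : GaugeConfig 3 1 SU2 => 4 - ((su2Rep (u ((0 : Site 3 1), (0 : Fin 3)))).trace.re) ^ 2) p.1 + flowLiftAt x 0 (fun u : GaugeConfig 3 1 SU2 => 4 - ((su2Rep (u ((0 : Site 3 1), (0 : Fin 3)))).trace.re) ^ 2) p.2) *
            (4 - 2 * (((p.1 ((fun z : Site 3 L => z.shift 0)^[j] x, 0) * (p.2 ((fun z : Site 3 L => z.shift 0)^[j] x, 0))⁻¹ : SU2) :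
              Matrix (Fin 2) (Fin 2) ℂ).trace.re)))
          ∂(configMeasure SU2 L).prod (configMeasure SU2 L) ≤
        (L : ℝ) * (η * (2 * (topValue su2Rep L β * l2 (fun U => flowLiftAt x 0 (fun u : GaugeConfig 3 1 SU2 => 4 - ((su2Rep (u ((0 : Site 3 1), (0 : Fin 3)))).trace.re) ^ 2) U * Ω U) Ω))) := by
    intro x
    calc _ ≤ ∑ _j ∈ Finset.range L, η * (2 * (topValue su2Rep L β * l2 (fun U => flowLiftAt x 0 (fun u : GaugeConfig 3 1 SU2 => 4 - ((su2Rep (u ((0 : Site 3 1), (0 : Fin 3)))).trace.re) ^ 2) U * Ω U) Ω)) :=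
          Finset.sum_le_sum fun j hj => by rw [← hJ x]; exact hW x j (Finset.mem_range.mp hj)
      _ = (L : ℝ) * (η * (2 * (topValue su2Rep L β * l2 (fun U => flowLiftAt x 0 (fun u : GaugeConfig 3 1 SU2 => 4 - ((su2Rep (u ((0 : Site 3 1), (0 : Fin 3)))).trace.re) ^ 2) U * Ω U) Ω))) := by
          rw [Finset.sum_const, Finset.card_range, nsmul_eq_mul]
  have hsum := Finset.sum_le_sum fun x (_ : x ∈ (Finset.univ : Finset (Site 3 L))) => hx x
  rw [← Finset.mul_sum, ← Finset.mul_sum, ← Finset.mul_sum, ← Finset.mul_sum, sum_l2_adjLoopAt_eq hΩ] at hsum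
  have hL0 : (0 : ℝ) ≤ 2 * (L : ℝ) / Fintype.card (Site 3 L) := by positivity
  refine hkin.trans ((mul_le_mul_of_nonneg_left hsum hL0).trans (le_of_eq ?_))
  field_simp
  ring

end Summit.QuantumFields.YangMills.Theorems.AdjointLoopFano

end
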